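import Literature.AlgebraicGeometry.Motives.JacobianBasePoint
import Literature.AlgebraicGeometry.HodgeTheory.RationalLattice
import Literature.AlgebraicTopology.SingularHomology.KroneckerDualMap
import Literature.AlgebraicTopology.SingularHomology.LoopClassesSpan
import HarnessLib

/-!
# The Jacobian of a curve: reduction of `(f^P)^* : H¹(J(ℂ); ℚ) ≅ H¹(C(ℂ); ℚ)` to the fundamental group

Third proof file towards the named fact
`Literature.AlgebraicGeometry.Motives.isIso_bettiCohomology_map_abelJacobi` of
`Literature/AlgebraicGeometry/Motives/Jacobian.lean` (Lange, *Abelian Varieties over the Complex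
Numbers* (2023), §4.1.1 and proof of Lemma 4.4.1; Milne, *Jacobian Varieties*, Thm. 2.5), after
`JacobianProofs.lean` (independence of the model) and `JacobianBasePoint.lean` (independence of
the base point). Lange's proof of Lemma 4.4.1 reads: `H¹(J, ℤ) = Hom(H₁(J, ℤ), ℤ)`,
`H¹(C, ℤ) = Hom(H₁(C, ℤ), ℤ)`, and `α_c^*` "is the transposed map of the isomorphism
`α_{c*} : H₁(C, ℤ) → H₁(J, ℤ) = H₁(C, ℤ)`". This file formalizes the two topological
transpositions in that sentence for the tree's abstract `Jacobian C` over `ℂ`: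

* `Jacobian.isIso_bettiCohomology_map_abelJacobi_iff_bijective`: `(f^P)^*` is an isomorphism on
  `H¹(-; ℚ)` iff `(f^P)_* : H₁(C(ℂ); ℚ) → H₁(J(ℂ); ℚ)` is bijective (Kronecker duality over a
  field, `isIso_singularCohomology_map_iff_of_field`; Hatcher, *Algebraic Topology*, §3.1);
* `Jacobian.injective_bettiCohomology_map_abelJacobi_of_index_ne_zero`: **`(f^P)^*` is injective
  on `H¹(-; ℚ)` as soon as `(f^P)_* π₁(C(ℂ), P)` has finite index in `π₁(J(ℂ), f^P(P))`** (loop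
  classes span `H₁(J(ℂ); ℚ)` of the path-connected group `J(ℂ)`, Hatcher Thm. 2A.1, the tree's
  `singularHomology.map_one_surjective_of_index_ne_zero`);
* `Jacobian.isIso_bettiCohomology_map_abelJacobi_of_index_ne_zero_of_finrank_le` and the assembly
  `isIso_bettiCohomology_map_abelJacobi_of_index_of_finrank`: **the named fact follows from**
  (i) finiteness of the index `[π₁(J(ℂ)) : (f^P)_* π₁(C(ℂ))]` and (ii) the inequality of Betti
  numbers `b₁(C(ℂ)) ≤ b₁(J(ℂ))`, for one pair `(𝒥, P)` per curve — `H¹(C(ℂ); ℚ)` and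
  `H¹(J(ℂ); ℚ)` being finite-dimensional (compact manifolds; the tree's
  `HodgeTheory.finite_singularCohomology_rat_complexPoints` with `AbelianVariety.isSmoothProjective_holds`).
  In Lange's proof (i) and (ii) both come from `J(C) = H⁰(ω_C)^* / H₁(C, ℤ)` (§4.1.1:
  `α_{c*} = id` on `H₁(C, ℤ) = Λ = π₁(J)`, and `rk Λ = 2g = b₁(C)`); they are what remains.
* `AlgPoints.map_surjective_of_surjective`: a surjective morphism of `ℂ`-schemes locally of finite
  type is surjective on complex points (Nullstellensatz: closed points of the Jacobson scheme `X`
  in the non-empty closed fibre over the closed point `P`), recorded here for the isogenies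
  `[n] : J → J` and `J' → J` of the covering-space arguments computing (i) and (ii).

Everything is proved; no new definitions, no new named facts.

## References

* H. Lange, *Abelian Varieties over the Complex Numbers*, Grundlehren Text Editions (2023),
  §4.1.1, Lemma 4.4.1 (proof). [Lange2023AbelianVarietiesC]
* J. S. Milne, *Jacobian Varieties*, Ch. VII of Cornell–Silverman (1986), Thm. 2.5.
  [Milne1986JacobianVarieties]
* A. Hatcher, *Algebraic Topology*, CUP 2002, §2.A Thm. 2A.1, §3.1 Thm. 3.2 and p. 198.
  [HatcherAT2002]
-/

universe u

open CategoryTheory AlgebraicGeometry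
open Literature.AlgebraicTopology.SingularHomology

noncomputable section

namespace Literature.AlgebraicGeometry.Motives

/-! ### Surjective morphisms are surjective on complex points -/

/-- **A surjective morphism of `ℂ`-schemes locally of finite type is surjective on complex points**:
for `P ∈ Y(ℂ)` the fibre of `f` over the closed point `P` is a non-empty closed subset of the
Jacobson space `X`, so it contains a closed point, i.e. (Nullstellensatz, the tree's
`ComplexPoints.equivClosedPoints`) a complex point `Q` of `X`, and `f(Q) = P` because complex points
are determined by their underlying points (Mumford, *Red Book*, I §10; Görtz–Wedhorn I,
Prop. 3.35). [folklore] -/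
theorem AlgPoints.map_surjective_of_surjective {X Y : SchemeOver ℂ} (f : X ⟶ Y)
    [LocallyOfFiniteType X.hom] [LocallyOfFiniteType Y.hom] [Surjective f.left] :
    Function.Surjective (AlgPoints.map (L := ℂ) f) := by
  intro P
  haveI : JacobsonSpace ↥X.left := LocallyOfFiniteType.jacobsonSpace X.hom
  -- the fibre over the closed point `P.pt` is closed and non-empty
  have hcl : IsClosed (f.left ⁻¹' ({P.pt} : Set Y.left)) :=
    (ComplexPoints.isClosed_pt P).preimage f.left.continuous
  obtain ⟨x, hx⟩ := ‹Surjective f.left›.surj P.pt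
  obtain ⟨q, hq, hqc⟩ := nonempty_inter_closedPoints (X := ↥X.left) ⟨x, hx⟩ hcl.isLocallyClosed
  refine ⟨(ComplexPoints.equivClosedPoints X).symm ⟨q, hqc⟩, ?_⟩
  apply (ComplexPoints.equivClosedPoints Y).injective
  apply Subtype.ext
  rw [ComplexPoints.coe_equivClosedPoints_apply, ComplexPoints.coe_equivClosedPoints_apply,
    AlgPoints.pt_map]
  have hq' : ((ComplexPoints.equivClosedPoints X).symm ⟨q, hqc⟩).pt = q := by
    have := ComplexPoints.coe_equivClosedPoints_apply X ((ComplexPoints.equivClosedPoints X).symm ⟨q, hqc⟩)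
    rw [Equiv.apply_symm_apply] at this
    exact this.symm
  rw [hq']
  exact Set.mem_singleton_iff.mp (Set.mem_preimage.mp hq)

/-! ### Finiteness of `H¹(C(ℂ); ℚ)` and `H¹(J(ℂ); ℚ)` -/

/-- `Hⁱ(C(ℂ); ℚ)` is finite-dimensional for a smooth projective `C/ℂ` (a compact manifold;
Hatcher App. A Cor. A.8–A.9; the tree's `HodgeTheory.finite_singularCohomology_rat_complexPoints`).
[cite: HatcherAT2002, App. A Cor. A.9 and §3.1 Cor. 3.3] -/
theorem finite_bettiCohomology_of_isSmoothProjective {n : ℕ} {X : SchemeOver ℂ}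
    (hX : IsSmoothProjective n X) (i : ℕ) : Module.Finite ℚ (bettiCohomology X i) :=
  Literature.AlgebraicGeometry.HodgeTheory.finite_singularCohomology_rat_complexPoints hX i

/-- `Hⁱ(A(ℂ); ℚ)` is finite-dimensional for an abelian variety `A/ℂ` (smooth projective,
`AbelianVariety.isSmoothProjective_holds`). [cite: HatcherAT2002, App. A Cor. A.9 and §3.1 Cor. 3.3] -/
instance AbelianVariety.finite_bettiCohomology (A : AbelianVariety ℂ) (i : ℕ) :
    Module.Finite ℚ (bettiCohomology A.X i) :=
  finite_bettiCohomology_of_isSmoothProjective (AbelianVariety.isSmoothProjective_holds (A := A)) i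

namespace Jacobian

variable {C : SchemeOver ℂ} (𝒥 : Jacobian C) (P : AlgPoints C ℂ)

/-! ### Kronecker duality: `(f^P)^*` on `H¹` versus `(f^P)_*` on `H₁` -/

/-- **`(f^P)^* : H¹(J(ℂ); ℚ) → H¹(C(ℂ); ℚ)` is an isomorphism iff
`(f^P)_* : H₁(C(ℂ); ℚ) → H₁(J(ℂ); ℚ)` is bijective** (Kronecker duality over the field `ℚ`,
Hatcher §3.1 Thm. 3.2 and p. 198, natural in the space: "`α_c^*` is the transposed map of `α_{c*}`",
Lange, proof of Lemma 4.4.1). [cite: Lange2023AbelianVarietiesC, Lemma 4.4.1 (proof)] -/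
theorem isIso_bettiCohomology_map_abelJacobi_iff_bijective (i : ℕ) :
    IsIso (bettiCohomology.map (𝒥.abelJacobi P) i) ↔
      Function.Bijective (singularHomology.map ℚ ℚ
        (AlgPoints.mapContinuous (L := ℂ) (𝒥.abelJacobi P)) i) :=
  isIso_singularCohomology_map_iff_of_field ℚ _ i

/-- **`(f^P)^*` is injective on `H¹(-; ℚ)` when `(f^P)_* π₁(C(ℂ), P)` has finite index in
`π₁(J(ℂ), f^P(P))`**: then `(f^P)_*` is onto `H₁(J(ℂ); ℚ)` (loop classes span `H₁` of the
path-connected `J(ℂ)` and a positive power of every loop class comes from `C`, Hatcher Thm. 2A.1;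
`singularHomology.map_one_surjective_of_index_ne_zero`), and `(f^P)^*` is its transpose.
[cite: HatcherAT2002, Thm. 2A.1] -/
theorem injective_bettiCohomology_map_abelJacobi_of_index_ne_zero
    (h : (FundamentalGroup.map (AlgPoints.mapContinuous (L := ℂ) (𝒥.abelJacobi P)) P).range.index ≠ 0) :
    Function.Injective (bettiCohomology.map (𝒥.abelJacobi P) 1) :=
  (singularCohomology_map_injective_iff_of_field ℚ _ 1).mpr
    (singularHomology.map_one_surjective_of_index_ne_zero (Y := 𝒥.J.Points ℂ) ℚ
      (AlgPoints.mapContinuous (L := ℂ) (𝒥.abelJacobi P)) P h)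

/-- An injective `(f^P)^*` forces `b₁(J(ℂ)) ≤ b₁(C(ℂ))` (`H¹(C(ℂ); ℚ)` is finite-dimensional).
[folklore] -/
theorem finrank_le_of_injective (hC : IsSmoothProjective 1 C)
    (hinj : Function.Injective (bettiCohomology.map (𝒥.abelJacobi P) 1)) :
    Module.finrank ℚ (bettiCohomology 𝒥.J.X 1) ≤ Module.finrank ℚ (bettiCohomology C 1) := by
  haveI := finite_bettiCohomology_of_isSmoothProjective hC 1
  exact LinearMap.finrank_le_finrank_of_injective (f := (bettiCohomology.map (𝒥.abelJacobi P) 1).hom)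
    hinj

/-- **`(f^P)^* : H¹(J(ℂ); ℚ) ≅ H¹(C(ℂ); ℚ)` from finite index on `π₁` and `b₁(C) ≤ b₁(J)`**: an
injective linear map from the finite-dimensional `H¹(J(ℂ); ℚ)` to `H¹(C(ℂ); ℚ)` of no larger
dimension is bijective. In Lange's proof both inputs come from `J(C) = H⁰(ω_C)^*/H₁(C, ℤ)`
(§4.1.1: `α_{c*} : H₁(C, ℤ) → H₁(J, ℤ) = Λ` is the identity, `rk Λ = 2g = b₁(C)`).
[cite: Lange2023AbelianVarietiesC, §4.1.1 and Lemma 4.4.1 (proof)] -/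
theorem isIso_bettiCohomology_map_abelJacobi_of_index_ne_zero_of_finrank_le (hC : IsSmoothProjective 1 C)
    (h : (FundamentalGroup.map (AlgPoints.mapContinuous (L := ℂ) (𝒥.abelJacobi P)) P).range.index ≠ 0)
    (hb : Module.finrank ℚ (bettiCohomology C 1) ≤ Module.finrank ℚ (bettiCohomology 𝒥.J.X 1)) :
    IsIso (bettiCohomology.map (𝒥.abelJacobi P) 1) := by
  haveI := finite_bettiCohomology_of_isSmoothProjective hC 1
  have hinj := 𝒥.injective_bettiCohomology_map_abelJacobi_of_index_ne_zero P h
  have heq : Module.finrank ℚ (bettiCohomology 𝒥.J.X 1) = Module.finrank ℚ (bettiCohomology C 1) :=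
    le_antisymm (𝒥.finrank_le_of_injective P hC hinj) hb
  have hbij : Function.Bijective (bettiCohomology.map (𝒥.abelJacobi P) 1).hom :=
    ⟨hinj, (LinearMap.injective_iff_surjective_of_finrank_eq_finrank heq).mp hinj⟩
  exact (LinearEquiv.ofBijective (bettiCohomology.map (𝒥.abelJacobi P) 1).hom hbij).toModuleIso.isIso_hom

end Jacobian

/-- **Reduction of the named fact to the fundamental group.** `isIso_bettiCohomology_map_abelJacobi`
holds as soon as, for every smooth projective curve `C/ℂ` with a Jacobian and a point, SOME Jacobian
`𝒥₀` and SOME point `P₀` satisfy: (i) `(f^{P₀})_* π₁(C(ℂ), P₀)` has finite index in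
`π₁(J₀(ℂ), f^{P₀}(P₀))`, and (ii) `b₁(C(ℂ)) ≤ b₁(J₀(ℂ))` (independence of the model, Milne
Rem. 6.5, and of the base point, Milne §2: `Jacobian.isIso_bettiCohomology_map_abelJacobi_of_exists`).
Lange §4.1.1 supplies (i) and (ii) for the analytic Jacobian (`Λ = H₁(C, ℤ)`).
[cite: Lange2023AbelianVarietiesC, §4.1.1 and Lemma 4.4.1 (proof)] -/
theorem isIso_bettiCohomology_map_abelJacobi_of_index_of_finrank
    (h : ∀ (C : SchemeOver ℂ), IsSmoothProjective 1 C → Nonempty (Jacobian C) →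
      Nonempty (AlgPoints C ℂ) → ∃ (𝒥₀ : Jacobian C) (P₀ : AlgPoints C ℂ),
        (FundamentalGroup.map (AlgPoints.mapContinuous (L := ℂ) (𝒥₀.abelJacobi P₀)) P₀).range.index ≠ 0 ∧
        Module.finrank ℚ (bettiCohomology C 1) ≤ Module.finrank ℚ (bettiCohomology 𝒥₀.J.X 1)) :
    isIso_bettiCohomology_map_abelJacobi := by
  refine Jacobian.isIso_bettiCohomology_map_abelJacobi_of_exists fun C hC h𝒥 hP ↦ ?_
  obtain ⟨𝒥₀, P₀, hi, hb⟩ := h C hC h𝒥 hP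
  exact ⟨𝒥₀, P₀, 𝒥₀.isIso_bettiCohomology_map_abelJacobi_of_index_ne_zero_of_finrank_le P₀ hC hi hb⟩

end Literature.AlgebraicGeometry.Motives

end
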